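import Summits.QuantumFields.YangMills.Theorems.BalabanUVNodesN18TwoBlockLoopStokesGrowth
import Summits.QuantumFields.YangMills.Theorems.BalabanUVNodesN18AveragedFactorPlaqLetters
import Literature.MathematicalPhysics.QuantumFieldTheory.Balaban1983to89.BlockAveragingPlaquetteBound
import HarnessLib

/-!
# N18 (β)-transport letters: the plaquette letter of the COMPLEX averaged field `|∂Ū(𝐔) − 1|` from run B's (1.13)–(1.14)

[DAGN18W3-G4 INTENT-7, file (7c)] — count-neutral helper toward K3⁷ `stmt-QuantumFields-20544` (NOT claimed, NOT closed).  YM mass gap (Clay) NOT proved by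
any of this; R4 closes the conditional finite-𝕋⁴ rung `BalabanLadder.UV` only.

[Balaban1987RG1] imposes (1.14) `|∂𝐔 − 1| < α₀ξ²` on the complex configuration `𝐔 = (exp iξA′)U` precisely so that condition (iii) transports under the
averaging (0.4) by [Balaban1985Averaging] Prop. 1 (51) read for `Gᶜ`-valued fields.  This file types that reading at FIRST ORDER with explicit growth:
`∂Ū(p′) = E₁S₁·E₂S₂·(E₃S₃)⁻¹·(E₄S₄)⁻¹` with `E_i = exp[mean log]` of the (0.4) loop variables of the four coarse bonds of `p′` (each within `t` of `1` by (7b) ★, so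
`‖E_i^{±1} − 1‖ ≤ 6t`, `BlockAveragingPlaquetteBound.norm_eml_sub_one_le_six_mul`) and `S_i` the straight transporters (`‖S_i^{±1}‖ ≤ K^L`), whose product
`S₁S₂S₃⁻¹S₄⁻¹ = 𝐔(∂□)` is the side-`L` square of (7b) ★ (within `b` of `1`); an eight-factor telescoping gives `‖∂Ū(p′) − 1‖ ≤ b + 6t·K^{4L}·((1+6t)³ + (1+6t)² + 2 + 6t)`.
* §1 `norm_prod8_sub_prod4_le` (the telescoping), `transl_emb_seg`, `holT_seg_neg`, `holT_rectWord_eq_straight` (`𝐔(∂□) = S₁S₂S₃⁻¹S₄⁻¹`), `plaq_avgUnits_eq_prod8`,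
  `norm_eml_unit_sub_one_le` ∕ `norm_eml_unit_inv_sub_one_le`, `norm_straightU_le_growth`, ★ `norm_plaq_avgUnits_sub_one_le_growth` (level `j → j+1`, any `P`);
* §2 ★★ `norm_plaq_TΦOfRecord_U_sub_one_le_framePlaq`: at the frames of record, from run B's `SatisfiesI_III` on `π(j,Y)` (`K = 1 + 2η_{j+1}α₁` from `Factors` + (i) + (ii),
  `a = α₀η_{j+1}²` from (iii)) — the `hplaq` conjunct of FILE G's `hrest` up to the displayed numerics.

0 `def`, 0 `sorry`.  References: T. Bałaban, CMP **109** (1987) 249–301 [Balaban1987RG1] ((0.4) p.253, (1.13)–(1.14) p.262); CMP **98** (1985) 17–51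
[Balaban1985Averaging] (Prop. 1 (51) p.26, (26)–(27) p.22, Prop. 7 p.43 «complex perturbations V′V₀»).
-/

noncomputable section

open scoped BigOperators Matrix.Norms.L2Operator
open NormedSpace

namespace YMDAG.N18.TransportOfRecord

open Literature.MathematicalPhysics.QuantumFieldTheory.Balaban1983to89
open Literature.MathematicalPhysics.QuantumFieldTheory.Balaban1983to89.T4Continuum
open Literature.MathematicalPhysics.QuantumFieldTheory.Balaban1983to89.T4LevelShift
open Literature.MathematicalPhysics.QuantumFieldTheory.Balaban1983to89.BlockAveraging
open Literature.MathematicalPhysics.QuantumFieldTheory.Balaban1983to89.B12RegularSpaces111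
open Literature.MathematicalPhysics.QuantumFieldTheory.Balaban1983to89.B12RegularSpaces111SpecialUnitary (suModel suModel_norm_le)
open Literature.MathematicalPhysics.QuantumFieldTheory.Balaban1983to89.B7Prop1Explicit renaming Site → LSite
open Literature.MathematicalPhysics.QuantumFieldTheory.Balaban1983to89.B7Prop1Explicit (Letter e e_apply disp hol seg seg_natCast seg_neg_natCast disp_seg revWord_seg
  hol_revWord' units_val_inv_eq_exp_neg)
open Literature.MathematicalPhysics.QuantumFieldTheory.Balaban1983to89.B7Prop1Local (InBox clampCfg clampCfg_agree)
open Literature.MathematicalPhysics.QuantumFieldTheory.Balaban1983to89.B10Eq27TorusAxialLog (transl transl_apply transl_zero pull hol_pull hol_pull_zero holT holT_append)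
open Literature.MathematicalPhysics.QuantumFieldTheory.Balaban1983to89.T4ReflectionCone (rectWord)
open Literature.MathematicalPhysics.QuantumFieldTheory.Balaban1983to89.ExpMeanLog (eml eml_eq_exp_sum isUnit_eml)
open Literature.MathematicalPhysics.QuantumFieldTheory.Balaban1983to89.MatrixLog (mlog norm_mlog_le_two_mul)
open Literature.MathematicalPhysics.QuantumFieldTheory.Balaban1983to89.BlockAveragingPlaquetteBound (norm_eml_sub_one_le_six_mul)
open Literature.MathematicalPhysics.QuantumFieldTheory.Balaban1983to89.B12Spaces329NearBond (inv_expI)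
open Literature.MathematicalPhysics.QuantumFieldTheory.Balaban1983to89.B7Prop7OneStep (norm_hol_le_pow)
open Literature.MathematicalPhysics.QuantumFieldTheory.Balaban1983to89.Node00 (MatA)
open Literature.MathematicalPhysics.QuantumFieldTheory.Balaban1983to89.Node00.W1
open Literature.MathematicalPhysics.QuantumFieldTheory.Balaban1983to89.Node00.Sect2 (regionOfSet domSys domSites frameI)
open YMDAG.N18.BoxStokes (disp_apply_eq_netDisp blockOf_transl_emb twoBlockBox_lo_le_hi hol_congr_of_inBox clampCfg_growth pull_growth_of_twoBlock
  norm_loopVarU_sub_one_le_of_plaq_twoBlock_growth norm_holT_rectWord_sub_one_le_of_plaq_fourBlock_growth)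

/-! ## §1 One level: `∂Ū(p′)` as an eight-fold product, and its distance to `1` -/

section Level

variable {𝔸 : Type*} [NormedRing 𝔸] [NormedAlgebra ℂ 𝔸] [CompleteSpace 𝔸] [NormOneClass 𝔸]

omit [NormedAlgebra ℂ 𝔸] [CompleteSpace 𝔸] in
/-- **The eight-factor telescoping**: if `‖eᵢ − 1‖ ≤ ε` (`ε ≥ 0`) and `‖sᵢ‖ ≤ s` for four + four elements, then
`‖e₁(s₁(e₂(s₂(s₃(e₃(s₄e₄)))))) − s₁(s₂(s₃s₄))‖ ≤ ε·s⁴·((1+ε)³ + (1+ε)² + (2+ε))` (`ez − z′ = (e − 1)z + (z − z′)`, `sz − sz′ = s(z − z′)`). [folklore] -/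
theorem norm_prod8_sub_prod4_le {e₁ e₂ e₃ e₄ s₁ s₂ s₃ s₄ : 𝔸} {ε s : ℝ} (hε : 0 ≤ ε) (hs : 0 ≤ s)
    (h₁ : ‖e₁ - 1‖ ≤ ε) (h₂ : ‖e₂ - 1‖ ≤ ε) (h₃ : ‖e₃ - 1‖ ≤ ε) (h₄ : ‖e₄ - 1‖ ≤ ε)
    (hs₁ : ‖s₁‖ ≤ s) (hs₂ : ‖s₂‖ ≤ s) (hs₃ : ‖s₃‖ ≤ s) (hs₄ : ‖s₄‖ ≤ s) :
    ‖e₁ * (s₁ * (e₂ * (s₂ * (s₃ * (e₃ * (s₄ * e₄)))))) - s₁ * (s₂ * (s₃ * s₄))‖ ≤ ε * s ^ 4 * ((1 + ε) ^ 3 + (1 + ε) ^ 2 + (2 + ε)) := by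
  -- norms of the `e`'s
  have hn : ∀ {x : 𝔸}, ‖x - 1‖ ≤ ε → ‖x‖ ≤ 1 + ε := fun {x} hx => by
    have := norm_le_norm_add_norm_sub' x 1; rw [norm_one] at this; linarith
  have he₁ := hn h₁; have he₂ := hn h₂; have he₃ := hn h₃; have he₄ := hn h₄
  -- the two elementary steps
  have stepE : ∀ (x z z' : 𝔸), ‖x * z - z'‖ ≤ ‖x - 1‖ * ‖z‖ + ‖z - z'‖ := fun x z z' => by
    have : x * z - z' = (x - 1) * z + (z - z') := by noncomm_ring
    rw [this]; exact (norm_add_le _ _).trans (add_le_add (norm_mul_le _ _) le_rfl)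
  have stepS : ∀ (x z z' : 𝔸), ‖x * z - x * z'‖ ≤ ‖x‖ * ‖z - z'‖ := fun x z z' => by rw [← mul_sub]; exact norm_mul_le _ _
  -- inside out
  have d8 : ‖e₄ - 1‖ ≤ ε := h₄
  have n8 : ‖s₄ * e₄‖ ≤ s * (1 + ε) := (norm_mul_le _ _).trans (mul_le_mul hs₄ he₄ (norm_nonneg _) hs)
  have d7 : ‖s₄ * e₄ - s₄‖ ≤ s * ε := by
    have := stepS s₄ e₄ 1; rw [mul_one] at this; exact this.trans (mul_le_mul hs₄ d8 (norm_nonneg _) hs)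
  have d6 : ‖e₃ * (s₄ * e₄) - s₄‖ ≤ ε * (s * (1 + ε)) + s * ε :=
    (stepE e₃ _ s₄).trans (add_le_add (mul_le_mul h₃ n8 (norm_nonneg _) hε) d7)
  have n6 : ‖e₃ * (s₄ * e₄)‖ ≤ (1 + ε) * (s * (1 + ε)) := (norm_mul_le _ _).trans (mul_le_mul he₃ n8 (norm_nonneg _) (by linarith))
  have d5 : ‖s₃ * (e₃ * (s₄ * e₄)) - s₃ * s₄‖ ≤ s * (ε * (s * (1 + ε)) + s * ε) :=
    (stepS s₃ _ s₄).trans (mul_le_mul hs₃ d6 (norm_nonneg _) hs)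
  have n5 : ‖s₃ * (e₃ * (s₄ * e₄))‖ ≤ s * ((1 + ε) * (s * (1 + ε))) := (norm_mul_le _ _).trans (mul_le_mul hs₃ n6 (norm_nonneg _) hs)
  have d4 : ‖s₂ * (s₃ * (e₃ * (s₄ * e₄))) - s₂ * (s₃ * s₄)‖ ≤ s * (s * (ε * (s * (1 + ε)) + s * ε)) :=
    (stepS s₂ _ _).trans (mul_le_mul hs₂ d5 (norm_nonneg _) hs)
  have n4 : ‖s₂ * (s₃ * (e₃ * (s₄ * e₄)))‖ ≤ s * (s * ((1 + ε) * (s * (1 + ε)))) := (norm_mul_le _ _).trans (mul_le_mul hs₂ n5 (norm_nonneg _) hs)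
  have d3 : ‖e₂ * (s₂ * (s₃ * (e₃ * (s₄ * e₄)))) - s₂ * (s₃ * s₄)‖ ≤ ε * (s * (s * ((1 + ε) * (s * (1 + ε))))) + s * (s * (ε * (s * (1 + ε)) + s * ε)) :=
    (stepE e₂ _ _).trans (add_le_add (mul_le_mul h₂ n4 (norm_nonneg _) hε) d4)
  have n3 : ‖e₂ * (s₂ * (s₃ * (e₃ * (s₄ * e₄))))‖ ≤ (1 + ε) * (s * (s * ((1 + ε) * (s * (1 + ε))))) :=
    (norm_mul_le _ _).trans (mul_le_mul he₂ n4 (norm_nonneg _) (by linarith))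
  have d2 : ‖s₁ * (e₂ * (s₂ * (s₃ * (e₃ * (s₄ * e₄))))) - s₁ * (s₂ * (s₃ * s₄))‖ ≤
      s * (ε * (s * (s * ((1 + ε) * (s * (1 + ε))))) + s * (s * (ε * (s * (1 + ε)) + s * ε))) :=
    (stepS s₁ _ _).trans (mul_le_mul hs₁ d3 (norm_nonneg _) hs)
  have n2 : ‖s₁ * (e₂ * (s₂ * (s₃ * (e₃ * (s₄ * e₄)))))‖ ≤ s * ((1 + ε) * (s * (s * ((1 + ε) * (s * (1 + ε)))))) :=
    (norm_mul_le _ _).trans (mul_le_mul hs₁ n3 (norm_nonneg _) hs)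
  have d1 := (stepE e₁ _ (s₁ * (s₂ * (s₃ * s₄)))).trans (add_le_add (mul_le_mul h₁ n2 (norm_nonneg _) hε) d2)
  refine d1.trans (le_of_eq ?_)
  ring

variable {P : Params} {j : ℕ}

omit [NormedAlgebra ℂ 𝔸] [CompleteSpace 𝔸] [NormOneClass 𝔸] in
/-- The straight segment ends at the next block centre: `emb y + L e_μ = emb (y + e_μ)`. [cite: Balaban1987RG1, (0.3)-(0.4) pp.252-253] -/
theorem transl_emb_seg (y : Site P (j + 1)) (μ : Fin P.d) : transl (emb y) (((P.L : ℕ) : ℤ) • e μ) = emb (y.shift μ) := by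
  funext ν
  rw [transl_apply, emb_shift_apply, Pi.smul_apply, e_apply, smul_eq_mul]
  by_cases h : ν = μ
  · subst h; simp
  · simp [h]

omit [NormedAlgebra ℂ 𝔸] [CompleteSpace 𝔸] [NormOneClass 𝔸] in
/-- A backward straight segment read from its far end is the inverse of the forward one. [cite: Balaban1985Averaging, (9) p.18] -/
theorem holT_seg_neg (U : GaugeField P j 𝔸ˣ) (x : Site P j) (κ : Fin P.d) (n : ℕ) :
    holT U (transl x ((n : ℤ) • e κ)) (seg κ (-(n : ℤ))) = (holT U x (seg κ n))⁻¹ := by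
  rw [← hol_pull, ← hol_pull_zero, ← revWord_seg]
  exact hol_revWord' (pull U x) ((n : ℤ) • e κ) (seg κ n) (by rw [disp_seg, zero_add])

omit [NormedAlgebra ℂ 𝔸] [CompleteSpace 𝔸] [NormOneClass 𝔸] in
/-- **`S₁S₂S₃⁻¹S₄⁻¹ = 𝐔(∂□)`**: the straight transporters of the four coarse bonds of `p′ = ⟨y; μ, ν⟩` multiply to the side-`L` square read from `emb y`.
[cite: Balaban1985Averaging, Prop. 1 (51) p.26] -/
theorem holT_rectWord_eq_straight (U : GaugeField P j 𝔸ˣ) (y : Site P (j + 1)) (μ ν : Fin P.d) :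
    holT U (emb y) (rectWord μ ν P.L P.L) =
      straightU U ⟨y, μ⟩ * (straightU U ⟨y.shift μ, ν⟩ * ((straightU U ⟨y.shift ν, μ⟩)⁻¹ * (straightU U ⟨y, ν⟩)⁻¹)) := by
  have hw : rectWord μ ν P.L P.L = seg μ P.L ++ seg ν P.L ++ seg μ (-(P.L : ℤ)) ++ seg ν (-(P.L : ℤ)) := by
    rw [rectWord, seg_natCast, seg_natCast, seg_neg_natCast, seg_neg_natCast]
  rw [hw, holT_append, holT_append, holT_append]
  simp only [B7Prop1Explicit.disp_append, disp_seg]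
  have e1 : transl (emb y) (((P.L : ℕ) : ℤ) • e μ) = emb (y.shift μ) := transl_emb_seg y μ
  have e2 : transl (emb y) (((P.L : ℕ) : ℤ) • e μ + ((P.L : ℕ) : ℤ) • e ν) = transl (emb (y.shift ν)) (((P.L : ℕ) : ℤ) • e μ) := by
    rw [← transl_emb_seg y ν]; funext κ; simp only [transl_apply, Pi.add_apply]; push_cast; ring
  have e3 : transl (emb y) (((P.L : ℕ) : ℤ) • e μ + ((P.L : ℕ) : ℤ) • e ν + -(((P.L : ℕ) : ℤ)) • e μ) = transl (emb y) (((P.L : ℕ) : ℤ) • e ν) := by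
    congr 1; rw [neg_smul]; abel
  rw [e1, e2, e3, holT_seg_neg, holT_seg_neg, mul_assoc, mul_assoc]
  rfl

omit [NormOneClass 𝔸] in
/-- **`∂Ū(p′)` AS AN EIGHT-FOLD PRODUCT** `E₁S₁E₂S₂S₃⁻¹E₃⁻¹S₄⁻¹E₄⁻¹`, `Ū(c) = E(c)S(c)` (W1's `val_avgUnits`). [cite: Balaban1987RG1, (0.4) p.253] -/
theorem plaq_avgUnits_eq_prod8 (U : GaugeField P j 𝔸ˣ) (y : Site P (j + 1)) {μ ν : Fin P.d} (hμν : μ < ν) :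
    ((plaq (avgUnits U) ⟨y, μ, ν, hμν⟩ : 𝔸ˣ) : 𝔸) =
      eml (fun i : Idx P => ((loopVarU U ⟨y, μ⟩ i : 𝔸ˣ) : 𝔸)) *
        ((((straightU U ⟨y, μ⟩ : 𝔸ˣ) : 𝔸)) *
          (eml (fun i : Idx P => ((loopVarU U ⟨y.shift μ, ν⟩ i : 𝔸ˣ) : 𝔸)) *
            ((((straightU U ⟨y.shift μ, ν⟩ : 𝔸ˣ) : 𝔸)) *
              ((((straightU U ⟨y.shift ν, μ⟩)⁻¹ : 𝔸ˣ) : 𝔸) *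
                (((((isUnit_eml (fun i : Idx P => ((loopVarU U ⟨y.shift ν, μ⟩ i : 𝔸ˣ) : 𝔸))).unit)⁻¹ : 𝔸ˣ) : 𝔸) *
                  ((((straightU U ⟨y, ν⟩)⁻¹ : 𝔸ˣ) : 𝔸) *
                    ((((isUnit_eml (fun i : Idx P => ((loopVarU U ⟨y, ν⟩ i : 𝔸ˣ) : 𝔸))).unit)⁻¹ : 𝔸ˣ) : 𝔸))))))) := by
  rw [plaq_eq]
  show (((avgUnits U ⟨y, μ⟩ * avgUnits U ⟨y.shift μ, ν⟩ * (avgUnits U ⟨y.shift ν, μ⟩)⁻¹ * (avgUnits U ⟨y, ν⟩)⁻¹ : 𝔸ˣ)) : 𝔸) = _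
  simp only [avgUnits, mul_inv_rev, Units.val_mul, IsUnit.unit_spec, mul_assoc]

omit [NormOneClass 𝔸] in
/-- `‖E(c) − 1‖ ≤ 6t` when the loop variables are within `t ≤ 1∕2` of `1`. [cite: Balaban1985Averaging, (26)-(27) p.22] -/
theorem norm_eml_unit_sub_one_le {W : Idx P → 𝔸} {t : ℝ} (hW : ∀ i, ‖W i - 1‖ ≤ t) (ht : t ≤ 1 / 2) :
    ‖(((isUnit_eml W).unit : 𝔸ˣ) : 𝔸) - 1‖ ≤ 6 * t := by
  rw [IsUnit.unit_spec]; exact norm_eml_sub_one_le_six_mul hW ht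

omit [NormOneClass 𝔸] in
/-- `‖E(c)⁻¹ − 1‖ ≤ 6t` when the loop variables are within `t ≤ 1∕2` of `1`: `E⁻¹ = exp(−|I|⁻¹Σ log W_i)`, `‖Σ‖ ≤ 2t`, `e^{2t} − 1 ≤ 4t`.
[cite: Balaban1985Averaging, (26)-(27) p.22] -/
theorem norm_eml_unit_inv_sub_one_le {W : Idx P → 𝔸} {t : ℝ} (hW : ∀ i, ‖W i - 1‖ ≤ t) (ht : t ≤ 1 / 2) :
    ‖((((isUnit_eml W).unit)⁻¹ : 𝔸ˣ) : 𝔸) - 1‖ ≤ 6 * t := by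
  have h0 : 0 ≤ t := (norm_nonneg _).trans (hW (Classical.arbitrary _))
  have hc : (0 : ℝ) < Fintype.card (Idx P) := Nat.cast_pos.mpr Fintype.card_pos
  set B : 𝔸 := ∑ i, ((Fintype.card (Idx P) : ℝ))⁻¹ • mlog (W i) with hB
  have hval : (((isUnit_eml W).unit : 𝔸ˣ) : 𝔸) = exp B := by rw [IsUnit.unit_spec, eml_eq_exp_sum]
  rw [units_val_inv_eq_exp_neg hval]
  have hBn : ‖-B‖ ≤ 2 * t := by
    rw [norm_neg, hB]
    refine (norm_sum_le _ _).trans ?_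
    have hterm : ∀ i ∈ (Finset.univ : Finset (Idx P)), ‖((Fintype.card (Idx P) : ℝ))⁻¹ • mlog (W i)‖ ≤ ((Fintype.card (Idx P) : ℝ))⁻¹ * (2 * t) := by
      intro i _
      rw [norm_smul, norm_inv, Real.norm_natCast]
      exact mul_le_mul_of_nonneg_left ((norm_mlog_le_two_mul ((hW i).trans ht)).trans (by linarith [hW i])) (inv_nonneg.mpr hc.le)
    refine (Finset.sum_le_sum hterm).trans ?_
    rw [Finset.sum_const, Finset.card_univ, nsmul_eq_mul, ← mul_assoc, mul_inv_cancel₀ hc.ne', one_mul]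
  refine (B7Transfer.norm_exp_sub_one_le_of_le (-B) hBn).trans ?_
  have h2t : |2 * t| ≤ 1 := by rw [abs_of_nonneg (by linarith)]; linarith
  have h := Real.abs_exp_sub_one_le h2t
  rw [abs_of_nonneg (by linarith : (0 : ℝ) ≤ 2 * t)] at h
  have := (abs_le.mp h).2
  linarith

omit [NormedAlgebra ℂ 𝔸] [CompleteSpace 𝔸] in
/-- **The straight transporter of a coarse bond has `‖S(c)‖, ‖S(c)⁻¹‖ ≤ K^L`** when the bond variables with both ends in `B(c₋) ∪ B(c₊)` have `‖·‖, ‖·⁻¹‖ ≤ K`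
(`K ≥ 1`; the straight walk stays in the two-block box; clamped pullback + `B7Prop7OneStep.norm_hol_le_pow`). [cite: Balaban1987RG1, (0.4) p.253] -/
theorem norm_straightU_le_growth (hj : j + 1 ≤ P.m + P.K) {U : GaugeField P j 𝔸ˣ} (c : PBond P (j + 1)) {K : ℝ} (hK1 : 1 ≤ K)
    (hK : ∀ b : PBond P j, (blockOf b.src = c.src ∨ blockOf b.src = c.tgt) → (blockOf b.tgt = c.src ∨ blockOf b.tgt = c.tgt) →
      ‖((U b : 𝔸ˣ) : 𝔸)‖ ≤ K ∧ ‖(((U b)⁻¹ : 𝔸ˣ) : 𝔸)‖ ≤ K) :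
    ‖((straightU U c : 𝔸ˣ) : 𝔸)‖ ≤ K ^ P.L ∧ ‖(((straightU U c)⁻¹ : 𝔸ˣ) : 𝔸)‖ ≤ K ^ P.L := by
  set lo : LSite P.d := fun _ => -(((P.L - 1) / 2 : ℕ) : ℤ) with hlo
  set hi : LSite P.d := fun ν => (if c.dir = ν then (P.L : ℤ) else 0) + (((P.L - 1) / 2 : ℕ) : ℤ) with hhi
  have hwalk : ∀ k, InBox lo hi ((0 : LSite P.d) + disp ((List.replicate P.L (c.dir, true)).take k)) := fun k ν => by
    rw [zero_add, disp_apply_eq_netDisp, netDisp_take_replicate]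
    simp only [hlo, hhi, if_true]
    constructor
    · split_ifs <;> push_cast <;> omega
    · split_ifs <;> push_cast <;> omega
  set V' := clampCfg lo hi (pull U (emb c.src)) with hV'
  have hK' : ∀ x κ, ‖((V' x κ : 𝔸ˣ) : 𝔸)‖ ≤ K ∧ ‖(((V' x κ)⁻¹ : 𝔸ˣ) : 𝔸)‖ ≤ K :=
    clampCfg_growth (twoBlockBox_lo_le_hi c) hK1 (pull_growth_of_twoBlock hj c hK)
  have heq : straightU U c = hol V' 0 (List.replicate P.L (c.dir, true)) := by
    rw [straightU, ← hol_pull_zero]; exact (hol_congr_of_inBox (clampCfg_agree _) _ 0 hwalk).symm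
  rw [heq]
  have := norm_hol_le_pow (zero_le_one.trans hK1) hK' (List.replicate P.L (c.dir, true)) 0
  rwa [List.length_replicate] at this

/-- ★ **THE PLAQUETTE VARIABLES OF THE COMPLEXIFIED AVERAGE OF A NORM-BOUNDED CONFIGURATION** ([Balaban1985Averaging] Prop. 1 (51) for `Gᶜ`-valued fields, FIRST
ORDER, explicit growth): if on the bonds with both ends in the four blocks of the coarse plaquette `p′ = ⟨y; μ, ν⟩` the configuration has `‖U(b)‖, ‖U(b)⁻¹‖ ≤ K`
(`K ≥ 1`), on the plaquettes with all four corners there `‖∂U − 1‖ ≤ a`, the two-block loop rate of (7b) is `≤ t ≤ 1∕2` and the four-block square rate is `≤ b`, then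
`‖∂Ū(p′) − 1‖ ≤ b + 6t·(K^L)⁴·((1+6t)³ + (1+6t)² + (2+6t))`. [cite: Balaban1985Averaging, Prop. 1 (51) p.26 and Prop. 7 p.43; Balaban1987RG1, (1.14) p.262] -/
theorem norm_plaq_avgUnits_sub_one_le_growth (hj : j + 1 ≤ P.m + P.K) {U : GaugeField P j 𝔸ˣ} (y : Site P (j + 1)) {μ ν : Fin P.d} (hμν : μ < ν)
    {K a t b : ℝ} (hK1 : 1 ≤ K) (ha : 0 ≤ a)
    (hK : ∀ b' : PBond P j, (blockOf b'.src = y ∨ blockOf b'.src = y.shift μ ∨ blockOf b'.src = y.shift ν ∨ blockOf b'.src = (y.shift μ).shift ν) →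
      (blockOf b'.tgt = y ∨ blockOf b'.tgt = y.shift μ ∨ blockOf b'.tgt = y.shift ν ∨ blockOf b'.tgt = (y.shift μ).shift ν) →
      ‖((U b' : 𝔸ˣ) : 𝔸)‖ ≤ K ∧ ‖(((U b')⁻¹ : 𝔸ˣ) : 𝔸)‖ ≤ K)
    (hplaq : ∀ q : Plaq P j,
      (blockOf q.src = y ∨ blockOf q.src = y.shift μ ∨ blockOf q.src = y.shift ν ∨ blockOf q.src = (y.shift μ).shift ν) →
      (blockOf (q.src.shift q.μ) = y ∨ blockOf (q.src.shift q.μ) = y.shift μ ∨ blockOf (q.src.shift q.μ) = y.shift ν ∨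
        blockOf (q.src.shift q.μ) = (y.shift μ).shift ν) →
      (blockOf (q.src.shift q.ν) = y ∨ blockOf (q.src.shift q.ν) = y.shift μ ∨ blockOf (q.src.shift q.ν) = y.shift ν ∨
        blockOf (q.src.shift q.ν) = (y.shift μ).shift ν) →
      (blockOf ((q.src.shift q.μ).shift q.ν) = y ∨ blockOf ((q.src.shift q.μ).shift q.ν) = y.shift μ ∨ blockOf ((q.src.shift q.μ).shift q.ν) = y.shift ν ∨
        blockOf ((q.src.shift q.μ).shift q.ν) = (y.shift μ).shift ν) →
      ‖((plaq U q : 𝔸ˣ) : 𝔸) - 1‖ ≤ a)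
    (ht2 : (1 + K ^ (2 * ((P.d + 2) * P.L / 2) + 1) * (K ^ (4 * ((P.d + 2) * P.L / 2)) * (((P.d + 2) * P.L / 2 : ℕ) * (K ^ 6 * (K ^ 4 * a)) *
        (K ^ 2 * (1 + K ^ 6 * (K ^ 4 * a))) ^ ((P.d + 2) * P.L / 2)))) ^ ((P.d + 2) * P.L) - 1 ≤ t) (ht : t ≤ 1 / 2)
    (hb4 : (1 + K ^ (2 * ((P.d + 4) * P.L / 2) + 1) * (K ^ (4 * ((P.d + 4) * P.L / 2)) * (((P.d + 4) * P.L / 2 : ℕ) * (K ^ 6 * (K ^ 4 * a)) *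
        (K ^ 2 * (1 + K ^ 6 * (K ^ 4 * a))) ^ ((P.d + 4) * P.L / 2)))) ^ (4 * P.L) - 1 ≤ b) :
    ‖((plaq (avgUnits U) ⟨y, μ, ν, hμν⟩ : 𝔸ˣ) : 𝔸) - 1‖ ≤ b + 6 * t * (K ^ P.L) ^ 4 * ((1 + 6 * t) ^ 3 + (1 + 6 * t) ^ 2 + (2 + 6 * t)) := by
  have hK0 : 0 ≤ K := zero_le_one.trans hK1
  have hγ0 : 0 ≤ K ^ (2 * ((P.d + 2) * P.L / 2) + 1) * (K ^ (4 * ((P.d + 2) * P.L / 2)) * (((P.d + 2) * P.L / 2 : ℕ) * (K ^ 6 * (K ^ 4 * a)) *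
      (K ^ 2 * (1 + K ^ 6 * (K ^ 4 * a))) ^ ((P.d + 2) * P.L / 2))) := by positivity
  have h1p : (1 : ℝ) ≤ (1 + K ^ (2 * ((P.d + 2) * P.L / 2) + 1) * (K ^ (4 * ((P.d + 2) * P.L / 2)) * (((P.d + 2) * P.L / 2 : ℕ) * (K ^ 6 * (K ^ 4 * a)) *
      (K ^ 2 * (1 + K ^ 6 * (K ^ 4 * a))) ^ ((P.d + 2) * P.L / 2)))) ^ ((P.d + 2) * P.L) := one_le_pow₀ (by linarith)
  have h0 : 0 ≤ t := by linarith
  -- the two-block hypotheses at each of the four coarse bonds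
  have hbond : ∀ c : PBond P (j + 1),
      (∀ x : Site P j, (blockOf x = c.src ∨ blockOf x = c.tgt) → (blockOf x = y ∨ blockOf x = y.shift μ ∨ blockOf x = y.shift ν ∨ blockOf x = (y.shift μ).shift ν)) →
      (∀ i, ‖((loopVarU U c i : 𝔸ˣ) : 𝔸) - 1‖ ≤ t) ∧ ‖((straightU U c : 𝔸ˣ) : 𝔸)‖ ≤ K ^ P.L ∧ ‖(((straightU U c)⁻¹ : 𝔸ˣ) : 𝔸)‖ ≤ K ^ P.L := by
    intro c hc
    have hKc : ∀ b' : PBond P j, (blockOf b'.src = c.src ∨ blockOf b'.src = c.tgt) → (blockOf b'.tgt = c.src ∨ blockOf b'.tgt = c.tgt) →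
        ‖((U b' : 𝔸ˣ) : 𝔸)‖ ≤ K ∧ ‖(((U b')⁻¹ : 𝔸ˣ) : 𝔸)‖ ≤ K := fun b' h1 h2 => hK b' (hc _ h1) (hc _ h2)
    refine ⟨fun i => (norm_loopVarU_sub_one_le_of_plaq_twoBlock_growth hj c hK1 ha hKc (fun q h1 h2 h3 h4 => hplaq q (hc _ h1) (hc _ h2) (hc _ h3) (hc _ h4)) i).trans
      ht2, norm_straightU_le_growth hj c hK1 hKc⟩
  obtain ⟨w1, s1, s1'⟩ := hbond ⟨y, μ⟩ fun x h => h.elim Or.inl fun h => Or.inr (Or.inl h)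
  obtain ⟨w2, s2, s2'⟩ := hbond ⟨y.shift μ, ν⟩ fun x h => h.elim (fun h => Or.inr (Or.inl h)) fun h => Or.inr (Or.inr (Or.inr h))
  obtain ⟨w3, s3, s3'⟩ := hbond ⟨y.shift ν, μ⟩ fun x h => h.elim (fun h => Or.inr (Or.inr (Or.inl h))) fun h => Or.inr (Or.inr (Or.inr (by
    rw [h]; exact BlockAveragingEMLProp2.shift_shift_comm y ν μ)))
  obtain ⟨w4, s4, s4'⟩ := hbond ⟨y, ν⟩ fun x h => h.elim Or.inl fun h => Or.inr (Or.inr (Or.inl h))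
  -- the square
  have hsq := norm_holT_rectWord_sub_one_le_of_plaq_fourBlock_growth hj y (ne_of_lt hμν) hK1 ha hK hplaq
  rw [holT_rectWord_eq_straight, Units.val_mul, Units.val_mul, Units.val_mul] at hsq
  -- the telescoping
  rw [plaq_avgUnits_eq_prod8]
  have hε : 0 ≤ 6 * t := by linarith
  have h8 := norm_prod8_sub_prod4_le hε (pow_nonneg hK0 P.L) (norm_eml_sub_one_le_six_mul w1 ht) (norm_eml_sub_one_le_six_mul w2 ht)
    (norm_eml_unit_inv_sub_one_le w3 ht) (norm_eml_unit_inv_sub_one_le w4 ht) s1 s2 s3' s4'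
  have hsq' := hsq.trans hb4
  set R : 𝔸 := ((straightU U ⟨y, μ⟩ : 𝔸ˣ) : 𝔸) * (((straightU U ⟨y.shift μ, ν⟩ : 𝔸ˣ) : 𝔸) *
      ((((straightU U ⟨y.shift ν, μ⟩)⁻¹ : 𝔸ˣ) : 𝔸) * (((straightU U ⟨y, ν⟩)⁻¹ : 𝔸ˣ) : 𝔸))) with hR
  refine (norm_sub_le_norm_sub_add_norm_sub _ R 1).trans ?_
  linarith

end Level

/-! ## §2 At the frames of record: the `hplaq` conjunct of FILE G's `hrest`, up to numerics -/

section Record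

variable {F : T4Family} {N k : ℕ} [NeZero N]

/-- **The complex configuration of run B is norm-bounded on its region**: from `𝐔 = (exp iξA′)U` with `U ∈ SU(N)` (i) and `|A′| < α₁` (ii) on the region's bonds,
`‖𝐔(b)‖, ‖𝐔(b)⁻¹‖ ≤ 1 + 2ξα₁` (`ξα₁ ≤ 1∕2`). [cite: Balaban1987RG1, (1.11)-(1.13) p.262] -/
theorem norm_factors_le_growth {P : Params} {FB : Frame P 0 (MatA N)} {cB : StepConsts} {α₀ α₁ : ℝ} {Uc U : PBond P 0 → (MatA N)ˣ} {A' : PBond P 0 → MatA N}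
    (hf : Factors cB Uc U A') (hI : CondI (suModel N) FB cB α₀ U) (hII : CondII (suModel N) FB.X cB α₁ U A') (hξ : 0 ≤ cB.ξ) (hξ₁ : cB.ξ * α₁ ≤ 1 / 2)
    (b : PBond P 0) (hb : b ∈ FB.X.bonds) :
    ‖((Uc b : (MatA N)ˣ) : MatA N)‖ ≤ 1 + 2 * (cB.ξ * α₁) ∧ ‖(((Uc b)⁻¹ : (MatA N)ˣ) : MatA N)‖ ≤ 1 + 2 * (cB.ξ * α₁) := by
  have hA : ‖A' b‖ ≤ α₁ := (hII.norm_lt b hb).le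
  have hA1 : cB.ξ * ‖A' b‖ ≤ 1 := (mul_le_mul_of_nonneg_left hA hξ).trans (by linarith)
  have hU1 : ‖((U b : (MatA N)ˣ) : MatA N)‖ ≤ 1 := suModel_norm_le _ (hI.gValued b hb)
  have hU2 : ‖(((U b)⁻¹ : (MatA N)ˣ) : MatA N)‖ ≤ 1 := suModel_norm_le _ ((suModel N).G.inv_mem (hI.gValued b hb))
  have he : ∀ a : MatA N, cB.ξ * ‖a‖ ≤ 1 → ‖a‖ ≤ α₁ → ‖((expI cB.ξ a : (MatA N)ˣ) : MatA N)‖ ≤ 1 + 2 * (cB.ξ * α₁) := fun a h1 h2 => by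
    have h := norm_coe_expI_sub_one_le hξ h1
    have := norm_le_norm_add_norm_sub' ((expI cB.ξ a : (MatA N)ˣ) : MatA N) 1
    rw [norm_one] at this
    nlinarith [mul_le_mul_of_nonneg_left h2 hξ]
  have h0 : 0 ≤ 1 + 2 * (cB.ξ * α₁) := by nlinarith [norm_nonneg (A' b), mul_le_mul_of_nonneg_left hA hξ, mul_nonneg hξ (norm_nonneg (A' b))]
  rw [hf b, mul_inv_rev, Units.val_mul, Units.val_mul, inv_expI]
  refine ⟨(norm_mul_le _ _).trans ((mul_le_mul (he _ hA1 hA) hU1 (norm_nonneg _) h0).trans (by rw [mul_one])),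
    (norm_mul_le _ _).trans ((mul_le_mul hU2 (he _ (by rwa [norm_neg]) (by rwa [norm_neg])) (norm_nonneg _) zero_le_one).trans (by rw [one_mul]))⟩

/-- ★★ **THE PLAQUETTE LETTER OF THE COMPLEX AVERAGED FIELD AT THE FRAMES OF RECORD, UP TO NUMERICS** ([Balaban1987RG1] (1.14) one scale up): for every `Φ`
satisfying (i)–(iii) of run B on the frame over `π(j,Y)` with constants `(cB, α₀, α₁, γ₀)` (`ξ_B = cB.ξ ≥ 0`, `ξ_Bα₁ ≤ 1∕2`, `α₀, α₁ ≥ 0`), and every plaquette `p` of run A's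
region over `Y`, `‖∂(TΦ(Φ).𝐔)(p) − 1‖ ≤ b + 6t·(K^L)⁴·((1+6t)³ + (1+6t)² + (2+6t))` with `K = 1 + 2ξ_Bα₁`, `a = α₀ξ_B²` and the loop ∕ square rates `t ≤ 1∕2`, `b`
of §1 ★ (displayed).  With `b + … < α₀A·ξ_A²` this is the `hplaq` conjunct of FILE G's `hrest`. [cite: Balaban1987RG1, (0.4) p.253, (1.11)-(1.14) p.262, (0.24)-(0.25) p.257;
Balaban1985Averaging, Prop. 1 (51) p.26] -/
theorem norm_plaq_TΦOfRecord_U_sub_one_le_framePlaq (Rz : Node00.Sect2.Residual (F.P (k + 1)) (MatA N)) (M j' : ℕ) (Y : (domSys (F.P k) M j').Dom)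
    {cB : StepConsts} {α₀ α₁ γ₀ : ℝ} {Φ : FieldPair (F.P (k + 1)) 0 (MatA N)ˣ (MatA N)}
    (hsat : SatisfiesI_III (suModel N) (frameI Rz M (j' + 1) (domSites (F.P (k + 1)) M (j' + 1) (pairOfRecord F M k ⟨j', Y⟩).2)) cB α₀ α₁ γ₀ Φ)
    (hξ : 0 ≤ cB.ξ) (hξ₁ : cB.ξ * α₁ ≤ 1 / 2) (hα₀ : 0 ≤ α₀) (hα₁ : 0 ≤ α₁) {t b : ℝ}
    (ht2 : (1 + (1 + 2 * (cB.ξ * α₁)) ^ (2 * (((F.P (k + 1)).d + 2) * (F.P (k + 1)).L / 2) + 1) * ((1 + 2 * (cB.ξ * α₁)) ^ (4 * (((F.P (k + 1)).d + 2) * (F.P (k + 1)).L / 2)) *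
        ((((F.P (k + 1)).d + 2) * (F.P (k + 1)).L / 2 : ℕ) * ((1 + 2 * (cB.ξ * α₁)) ^ 6 * ((1 + 2 * (cB.ξ * α₁)) ^ 4 * (α₀ * cB.ξ ^ 2))) *
        ((1 + 2 * (cB.ξ * α₁)) ^ 2 * (1 + (1 + 2 * (cB.ξ * α₁)) ^ 6 * ((1 + 2 * (cB.ξ * α₁)) ^ 4 * (α₀ * cB.ξ ^ 2)))) ^ (((F.P (k + 1)).d + 2) * (F.P (k + 1)).L / 2)))) ^
        (((F.P (k + 1)).d + 2) * (F.P (k + 1)).L) - 1 ≤ t) (ht : t ≤ 1 / 2)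
    (hb4 : (1 + (1 + 2 * (cB.ξ * α₁)) ^ (2 * (((F.P (k + 1)).d + 4) * (F.P (k + 1)).L / 2) + 1) * ((1 + 2 * (cB.ξ * α₁)) ^ (4 * (((F.P (k + 1)).d + 4) * (F.P (k + 1)).L / 2)) *
        ((((F.P (k + 1)).d + 4) * (F.P (k + 1)).L / 2 : ℕ) * ((1 + 2 * (cB.ξ * α₁)) ^ 6 * ((1 + 2 * (cB.ξ * α₁)) ^ 4 * (α₀ * cB.ξ ^ 2))) *
        ((1 + 2 * (cB.ξ * α₁)) ^ 2 * (1 + (1 + 2 * (cB.ξ * α₁)) ^ 6 * ((1 + 2 * (cB.ξ * α₁)) ^ 4 * (α₀ * cB.ξ ^ 2)))) ^ (((F.P (k + 1)).d + 4) * (F.P (k + 1)).L / 2)))) ^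
        (4 * (F.P (k + 1)).L) - 1 ≤ b)
    (p : Plaq (F.P k) 0) (hp : p ∈ (regionOfSet (F.P k) (domSites (F.P k) M j' Y)).plaqs) :
    ‖((plaq (TΦOfRecord F N k Φ).U p : (MatA N)ˣ) : MatA N) - 1‖ ≤
      b + 6 * t * ((1 + 2 * (cB.ξ * α₁)) ^ (F.P (k + 1)).L) ^ 4 * ((1 + 6 * t) ^ 3 + (1 + 6 * t) ^ 2 + (2 + 6 * t)) := by
  have hX : (frameI Rz M (j' + 1) (domSites (F.P (k + 1)) M (j' + 1) (pairOfRecord F M k ⟨j', Y⟩).2)).X =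
      regionOfSet (F.P (k + 1)) ((fun x => (siteShift (YMDAG.N18.TwoRunCubes.ladder F k)).symm (blockOf x)) ⁻¹' domSites (F.P k) M j' Y) := by
    show regionOfSet (F.P (k + 1)) (domSites (F.P (k + 1)) M (j' + 1) (pairOfRecord F M k ⟨j', Y⟩).2) = _
    rw [YMDAG.N18.TwoRunCubes.domSites_pairOfRecord_eq_preimage]
  have hj : 0 + 1 ≤ (F.P (k + 1)).m + (F.P (k + 1)).K := by simp only [T4Family.P_m, T4Family.P_K]; omega
  obtain ⟨-, -, U, A', hf, hI, hII, hIII⟩ := hsat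
  have hK1 : (1 : ℝ) ≤ 1 + 2 * (cB.ξ * α₁) := by nlinarith [mul_nonneg hξ hα₁]
  show ‖((plaq (fieldShift (sitesPerDir_ladder F (K := k) (j := 0) rfl rfl) (avgUnits Φ.U)) p : (MatA N)ˣ) : MatA N) - 1‖ ≤ _
  rw [plaq_fieldShift]
  refine norm_plaq_avgUnits_sub_one_le_growth hj _ p.hμν hK1 (mul_nonneg hα₀ (sq_nonneg _)) (fun b' h1 h2 => ?_) (fun q h1 h2 h3 h4 => ?_) ht2 ht hb4
  · refine norm_factors_le_growth hf hI hII hξ hξ₁ b' ?_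
    rw [hX]; exact fourBlocks_subset_bonds_preimage _ p hp b' h1 h2
  · refine (hIII.plaq_lt q ?_).le
    rw [hX]; exact fourBlocks_subset_plaqs_preimage _ p hp q h1 h2 h3 h4

end Record

end YMDAG.N18.TransportOfRecord

end
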